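import Summits.QuantumFields.YangMills.Theorems.BalabanUVNodesN09B12ZeroLetterFlatness
import Literature.MathematicalPhysics.QuantumFieldTheory.Balaban1983to89.B12Lemma4Concrete

/-!
# NODE N09 ([Balaban1987RG1] Lemma 4 (3.53) p. 280), FLAG №7 LOCATED RIDER 4, PART A — THE LETTER'S CURL IS THE PINNED BACKGROUND'S FIELD STRENGTH: for EVERY by-reference
# package `JInputs … τ n 𝐊 𝐀` (any letters, not only `𝐊 = 0`) its own (3.39)+(3.37)+(3.45)×2 give `‖∂(U_{k+1}(□₀, M˙(Φ₀))^{w⁻¹})(p) − 1 − iξ·∂𝐊(p)‖ ≤ δ₀′` (second order) on `X`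

T. Bałaban, *Renormalization group approach to lattice gauge field theories. I*, Commun. Math. Phys. **109** (1987) 249–301 [Balaban1987RG1] (= [I]), §3 pp. 275–280;
[15] = [Balaban1985Variational] ∕ [Balaban1985BackgroundPropagators].  TRACK A (YM-PLAN §2b), WIDTH SEAT `pub-ymgap-dag-n09-w5` (HUMAN RULING D-0154 ∕ director-ym R399 (3a)),
generation g3; fourth LOCATED RIDER to FLAG №7 of record (director-ym №209 «conjunct-1 JUNK-INHABITED at the unit recipe»; chair tags #4477∕#4618 «repair = proviso text»)
in this seat's lineage: p607123 ∕ p608883 (the zero-letter inhabitant of `B12Provisos Rz cB λ` survives every `Rz.Laws`-abiding ∕ unit-flat pin), p611726 (PART 1: a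
zero-`𝐊` package returns `δ₀`-flat data), p612606 (PART 2: orbit-tie (T) ∧ first-order non-flatness NF(δ₀) of the pin ⇒ №209's failing lemma; (T) alone idle at
`RzOfRecord`), p615304 (PART 3: `δ₀ < (1+2β)α₀ξ′²`).  THIS FILE = PART A (p07's package at ONE value of the variables, any value model); PART B
(`…N09B12LetterCurlPackageLaws`) reads it at NODE 00's objects.  Key of record it serves: K1⁷ `StabilityBAtRecordR13SepCoPH` = stmt-QuantumFields-20542 (`--supports`, helper).

WHY (one rung towards print's letters).  Riders 1–3 speak of the ZERO letter only.  Print's letter is `𝐊 = 𝐇_j(□₀, τQ(L⁻¹η𝐇_{k+1}(□₀, (1/i) log V(𝐔))))` ((3.26)–(3.30),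
(3.37)), and p07's by-reference package `JInputs … τ n 𝐊 𝐀` ties it to the PINNED `(k+1)`-background `B := U_{k+1}(□₀, M˙(Φ₀))` of the datum by its own fields: the identity
(3.39)+(3.37) `h339 : ∂(exp iξ𝐇)(p) = ∂(B^{w⁻¹})(p)` on `X` (`w = v ū₁ v_j u_j`, costs (3.26)∕(3.27)∕(3.37)) and the sizes (3.45)×2 `h45 : |ξ⁻¹∂𝐇(p) − ℓ(p)| < B₃y²`,
`h45τ : |ξ⁻¹∂𝐊(p) − τℓ(p)| < B₃y²` (`y = B₃O(1)Mα₀L^{j−1}η`; `∂𝐇(p)` = the four-term plaquette combination).  Eliminating `ℓ`: `|∂𝐊(p) − τ∂𝐇(p)| ≤ (1+τ)ξB₃y²` — at `τ = 1`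
the letter's curl IS `∂𝐇(p)` to second order, at `τ = 0` it is second order outright.  With the TWO-SIDED elementary inequality behind (3.43) at the unit background
(`B12Plaquette343.elem343` through `B12Lemma4Concrete.plaq_expI_eq_holonomy`: `|∂(exp iξ𝐇)(p) − 1 − iξ∂𝐇(p)| ≤ ½(4x′)²ξ²e^{4ξx′}`, `x′ = B₃²O(1)Mα₀L^{j−1}η` from (3.37)) and
`h339`:  **`‖∂(B^{w⁻¹})(p) − 1 − iξ∂𝐊(p)‖ ≤ δ₀′ := 2ξ²B₃y² + ½(4x′)²ξ²e^{4ξx′}`** on `X` at `τ = 1`, for EVERY package — the curl of the letter and the field strength of the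
pinned background (in the (3.39) gauge) are ONE first-order object; undoing the gauge costs `e^{c_w}` either way (`c_w = O(1)Mα₁ + 2B₃O(1)Mα₀ + B₃²O(1)Mα₀`; PART 1's `δ₀ = e^{c_w}δ₀′`).

WHAT IS PROVED (kernel bookkeeping; theorems only, def-free, sorry-free, standard axioms; nothing of p07 ∕ pub-balaban re-declared; PART 1 imported, not restated).
§1 (any algebra) `norm_plaq_expI_sub_one_sub_curl_le` (two-sided (3.43), curl form); `norm_plaq_gaugeU_inv_sub_one_le` (`‖∂(B^{w⁻¹})(p) − 1‖ ≤ ‖w(x)⁻¹‖‖∂B(p) − 1‖‖w(x)‖`).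
§2 (any model, `J : JInputs`, `0 < ξ`) ★ `norm_curlK_sub_smul_curlH_le` (`‖∂𝐊(p) − τ∂𝐇(p)‖ ≤ ξ(1+τ)B₃y²`, `0 ≤ τ`); `norm_curlK_le_of_tau_zero` (at `τ = 0`: `‖∂𝐊(p)‖ ≤ ξB₃y²` for
EVERY package, whatever the pin); ★★ `norm_plaq_bgGauge_sub_one_sub_curlK_le` (the identification, `τ = 1`); ★ `norm_smul_plaq_bgGauge_sub_one_sub_curlK_le` (all `τ ∈ [0,1]`:
`‖τ·(∂(B^{w⁻¹})(p) − 1) − iξ∂𝐊(p)‖ ≤ (1+τ)ξ²B₃y² + τ·½(4x′)²ξ²e^{4ξx′}`); ★ `norm_plaq_bg_sub_one_le_curlK` (`‖∂B(p) − 1‖ ≤ e^{c_w}(ξ‖∂𝐊(p)‖ + δ₀′)`; PART 1's ★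
`norm_plaq_bg_sub_one_le_of_jInputs` is its `∂𝐊 = 0` case, cited not restated); ★ `xi_mul_norm_curlK_le` (`ξ‖∂𝐊(p)‖ ≤ e^{c_w}‖∂B(p) − 1‖ + δ₀′`); ★★ `xi_mul_norm_curlK_lt_window`
(the datum's own (1.16) window at `n = k+1` CAPS the letter: `ξ‖∂𝐊(p)‖ < e^{c_w}(1+2β)α₀ξ′² + δ₀′` on `X ∩ (□₀)^{∼−2}`); `xi_mul_norm_curlK_le_of_flat_bg` (a flat pinned background
leaves the letter SECOND-ORDER CLOSED: `ξ‖∂𝐊(p)‖ ≤ δ₀′`).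

WHAT THIS MEANS FOR FLAG №7 (located; for director-ym ∕ dag-lead ∕ plan ∕ the def-T ∕ def-B12 desk ∕ referees; the NODE-00 corollaries are PART B).  The repaired proviso text's
two edits — (T) tie `JInputs.Φ₀` to the input, (P) pin `bgI` non-flat — act THROUGH THE LETTER'S CURL: whatever the pin's field strength on `X` is, a package's letter must
reproduce it to first order (so junk = «letters not carrying the pin's curvature», not merely «`𝐊 = 0`»), and conversely a flat pin (the unit recipe) forces every package's
letters, junk or print's, to be second-order closed on `X`; at `τ = 0` the letter's curl is second order for every package at every pin.

HONEST FRAMING: LOCATED, count-neutral kernel bookkeeping on p07's ∕ pub-balaban's objects read BY NAME; HYPOTHESIS-FORM — the package is a DISPLAYED hypothesis asserted of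
NO pin of record; `δ₀′` is OUR explicit constant (no optimisation); NOT Lemma 4 for `U_j(□₀, ·)`; NO estimate of Bałaban's is proved or denied; N09 NOT discharged; FLAG №7
neither closed nor widened (its located content made two-sided in the letters); K0⁷ ∕ K1⁷ NOT closed; counts unmoved (typed 28∕28 · discharged 5∕27); no summit statement
is proved by this seat; one finite four-torus programme at fixed `ε = L^{−K}` per run — conditional finite-𝕋⁴ bookkeeping; R4 closes rung `BalabanLadder.UV` only; NOT ℝ⁴,
NOT infinite volume, NOT OS, NOT a mass gap, NOT Clay.
-/

noncomputable section

namespace Summit.QuantumFields.YangMills.BalabanUVNodes.N09B12LetterCurlIsPinnedFieldStrength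

open Literature.MathematicalPhysics.QuantumFieldTheory.Balaban1983to89
open Summit.QuantumFields.YangMills.BalabanUVNodes.N09B12ZeroLetterFlatness (norm_plaq_sub_one_le_conj norm_mul_norm_inv_prod4_le)
open B12RegularSpaces111 (Frame Region StepConsts Model Satisfies expI plaq gaugeU)
open B12RegularSpaces111Gauge (gaugeU_one gaugeU_mul)
open B12Lemma4ConcreteFrame (JInputs)
open B12Lemma4Concrete (plaq_expI_eq_holonomy)
open B12Plaquette343 (elem343)
open B12Membership314 (norm_I_mul_smul)
open B9Eq369Product (norm_eta_inv_smul_le_iff)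
open Complex (I)

/-! ## §1. Elementary: the two-sided inequality behind (3.43) in curl form; conjugating a plaquette deviation back -/

section Elementary

variable {P : Params} {i : ℕ} {𝔸 : Type*} [NormedRing 𝔸] [NormedAlgebra ℂ 𝔸] [CompleteSpace 𝔸]

/-- **The elementary inequality behind (3.43), TWO-SIDED CURL FORM, at the unit background**: for a bond function `𝐇` with `‖𝐇(b)‖ ≤ h₀` and `ξ ≥ 0`,
`‖∂(exp iξ𝐇)(p) − 1 − iξ·(𝐇(b₁) + 𝐇(b₂) − 𝐇(b₃) − 𝐇(b₄))‖ ≤ ½(4h₀)²ξ²e^{ξ·4h₀}` (`b₁…b₄` the bonds of `p`) — `B12Plaquette343.elem343` for the four exponents, read on the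
carriers through `B12Lemma4Concrete.plaq_expI_eq_holonomy`. [cite: Balaban1987RG1, (3.43) p.278 (first inequality); (1.14) p.262] -/
theorem norm_plaq_expI_sub_one_sub_curl_le {ξ h₀ : ℝ} (hξ : 0 ≤ ξ) (H : PBond P i → 𝔸) (hH : ∀ b, ‖H b‖ ≤ h₀) (p : Plaq P i) :
    ‖((plaq (fun b => expI ξ (H b)) p : 𝔸ˣ) : 𝔸) - 1
        - (I * ξ) • (H ⟨p.src, p.μ⟩ + H ⟨p.src.shift p.μ, p.ν⟩ - H ⟨p.src.shift p.ν, p.μ⟩ - H ⟨p.src, p.ν⟩)‖ ≤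
      1 / 2 * (4 * h₀) ^ 2 * ξ ^ 2 * Real.exp (ξ * (4 * h₀)) := by
  rw [plaq_expI_eq_holonomy]
  refine (elem343 hξ _ _ _ _).trans ?_
  set S := ‖H ⟨p.src, p.μ⟩‖ + ‖H ⟨p.src.shift p.μ, p.ν⟩‖ + ‖H ⟨p.src.shift p.ν, p.μ⟩‖ + ‖H ⟨p.src, p.ν⟩‖ with hS
  have hS0 : 0 ≤ S := by positivity
  have hS4 : S ≤ 4 * h₀ := by
    have h₁ := hH ⟨p.src, p.μ⟩
    have h₂ := hH ⟨p.src.shift p.μ, p.ν⟩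
    have h₃ := hH ⟨p.src.shift p.ν, p.μ⟩
    have h₄ := hH ⟨p.src, p.ν⟩
    linarith
  have h1 : S ^ 2 ≤ (4 * h₀) ^ 2 := pow_le_pow_left₀ hS0 hS4 2
  have h2 : Real.exp (ξ * S) ≤ Real.exp (ξ * (4 * h₀)) := Real.exp_le_exp.mpr (mul_le_mul_of_nonneg_left hS4 hξ)
  exact mul_le_mul (mul_le_mul_of_nonneg_right (mul_le_mul_of_nonneg_left h1 (by norm_num)) (sq_nonneg ξ)) h2
    (Real.exp_pos _).le (by positivity)

omit [NormedAlgebra ℂ 𝔸] [CompleteSpace 𝔸] in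
/-- **Conjugating a plaquette deviation BACK**: `∂(B^{w⁻¹})(p) = w(x)⁻¹·∂B(p)·w(x)`, so `‖∂(B^{w⁻¹})(p) − 1‖ ≤ ‖w(x)⁻¹‖·‖∂B(p) − 1‖·‖w(x)‖` (PART 1's
`norm_plaq_sub_one_le_conj` at the transformation `w⁻¹`, with `(B^{w⁻¹})^{w} = B`). [cite: Balaban1987RG1, (1.10)–(1.11) p.262 (bookkeeping)] -/
theorem norm_plaq_gaugeU_inv_sub_one_le (w : Site P i → 𝔸ˣ) (B : PBond P i → 𝔸ˣ) (p : Plaq P i) :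
    ‖((plaq (gaugeU w⁻¹ B) p : 𝔸ˣ) : 𝔸) - 1‖ ≤
      ‖(((w p.src)⁻¹ : 𝔸ˣ) : 𝔸)‖ * ‖((plaq B p : 𝔸ˣ) : 𝔸) - 1‖ * ‖((w p.src : 𝔸ˣ) : 𝔸)‖ := by
  have h := norm_plaq_sub_one_le_conj w⁻¹ (gaugeU w⁻¹ B) p
  rw [inv_inv, ← gaugeU_mul, mul_inv_cancel, gaugeU_one] at h
  simpa only [Pi.inv_apply, inv_inv] using h

end Elementary

/-! ## §2. The core, for p07's by-reference package `JInputs` at ONE value of the variables (any value model, any frames) -/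

section Core

variable {P : Params} {i : ℕ} {𝔸 : Type} [NormedRing 𝔸] [NormedAlgebra ℂ 𝔸] [CompleteSpace 𝔸]
variable {𝓜 : Model 𝔸} {c : B12Sec2to5.Lemma4Consts} {F F' : Frame P i 𝔸} {cs cs' : StepConsts}
  {Y : Region P i} {π : 𝔸 →ₗ[ℂ] 𝔸} {η B₃'' γ₀' : ℝ} {j : ℕ} {τ n : ℝ} {K A : PBond P i → 𝔸}

/-- **★ THE LETTER'S CURL AGAINST `τ`·(THE CURL OF `𝐇`)** — eliminating `ℓ` between (3.45) at `Q` (`h45`) and at `τQ` (`h45τ`): for `0 ≤ τ`, `0 < ξ`,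
`‖∂𝐊(p) − τ·∂𝐇(p)‖ ≤ ξ·(1+τ)·B₃y²` on `X` (`y = B₃O(1)Mα₀L^{j−1}η`; `∂𝐊(p) = 𝐊(b₁) + 𝐊(b₂) − 𝐊(b₃) − 𝐊(b₄)`). [cite: Balaban1987RG1, (3.45) p.279 (at `Q` and at `τQ`)] -/
theorem norm_curlK_sub_smul_curlH_le (hξ : 0 < cs.ξ) (hτ : 0 ≤ τ) (J : JInputs 𝓜 c F F' cs cs' Y π η B₃'' γ₀' j τ n K A)
    (p : Plaq P i) (hp : p ∈ F.X.plaqs) :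
    ‖(K ⟨p.src, p.μ⟩ + K ⟨p.src.shift p.μ, p.ν⟩ - K ⟨p.src.shift p.ν, p.μ⟩ - K ⟨p.src, p.ν⟩)
        - (τ : ℂ) • (J.H ⟨p.src, p.μ⟩ + J.H ⟨p.src.shift p.μ, p.ν⟩ - J.H ⟨p.src.shift p.ν, p.μ⟩ - J.H ⟨p.src, p.ν⟩)‖ ≤
      cs.ξ * ((1 + τ) * (c.B₃ * (c.B₃ * c.O₁ * c.M * c.α₀ * (c.L ^ (j - 1) * η)) ^ 2)) := by
  set q : ℝ := c.B₃ * (c.B₃ * c.O₁ * c.M * c.α₀ * (c.L ^ (j - 1) * η)) ^ 2 with hq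
  set dK : 𝔸 := K ⟨p.src, p.μ⟩ + K ⟨p.src.shift p.μ, p.ν⟩ - K ⟨p.src.shift p.ν, p.μ⟩ - K ⟨p.src, p.ν⟩ with hdK
  set dH : 𝔸 := J.H ⟨p.src, p.μ⟩ + J.H ⟨p.src.shift p.μ, p.ν⟩ - J.H ⟨p.src.shift p.ν, p.μ⟩ - J.H ⟨p.src, p.ν⟩ with hdH
  have h45τ : ‖(cs.ξ : ℂ)⁻¹ • dK - (τ : ℂ) • J.ℓ p‖ < q := J.h45τ p hp
  have h45 : ‖(cs.ξ : ℂ)⁻¹ • dH - J.ℓ p‖ < q := J.h45 p hp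
  have hτn : ‖(τ : ℂ) • ((cs.ξ : ℂ)⁻¹ • dH - J.ℓ p)‖ ≤ τ * q := by
    rw [norm_smul, Complex.norm_real, Real.norm_of_nonneg hτ]
    exact mul_le_mul_of_nonneg_left h45.le hτ
  have hid : (cs.ξ : ℂ)⁻¹ • (dK - (τ : ℂ) • dH) =
      ((cs.ξ : ℂ)⁻¹ • dK - (τ : ℂ) • J.ℓ p) - (τ : ℂ) • ((cs.ξ : ℂ)⁻¹ • dH - J.ℓ p) := by
    module
  have h1 : ‖(cs.ξ : ℂ)⁻¹ • (dK - (τ : ℂ) • dH)‖ ≤ (1 + τ) * q := by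
    rw [hid]
    refine (norm_sub_le _ _).trans ?_
    linarith
  exact (norm_eta_inv_smul_le_iff hξ _).mp h1

/-- **AT `τ = 0` EVERY PACKAGE'S LETTER HAS SECOND-ORDER CURL ON `X`, WHATEVER THE PIN**: `‖∂𝐊(p)‖ ≤ ξ·B₃y²` (print: `𝐊 = 𝐇_j(□₀, τQ(…))` at `τ = 0`).
[cite: Balaban1987RG1, (3.45) p.279, (3.37) p.277] -/
theorem norm_curlK_le_of_tau_zero (hξ : 0 < cs.ξ) (J : JInputs 𝓜 c F F' cs cs' Y π η B₃'' γ₀' j τ n K A) (hτ : τ = 0)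
    (p : Plaq P i) (hp : p ∈ F.X.plaqs) :
    ‖K ⟨p.src, p.μ⟩ + K ⟨p.src.shift p.μ, p.ν⟩ - K ⟨p.src.shift p.ν, p.μ⟩ - K ⟨p.src, p.ν⟩‖ ≤
      cs.ξ * (c.B₃ * (c.B₃ * c.O₁ * c.M * c.α₀ * (c.L ^ (j - 1) * η)) ^ 2) := by
  have h := norm_curlK_sub_smul_curlH_le hξ (le_of_eq hτ.symm) J p hp
  simp only [hτ, Complex.ofReal_zero, zero_smul, sub_zero, add_zero, one_mul] at h
  exact h

/-- **★★ THE IDENTIFICATION: THE LETTER'S CURL IS THE PINNED BACKGROUND'S FIELD STRENGTH IN THE (3.39) GAUGE, TO SECOND ORDER.**  For `J : JInputs … τ n 𝐊 𝐀` at `τ = 1` with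
`0 < ξ`, on every `X`-plaquette `p`, with `B := U_{k+1}(□₀, M˙(Φ₀))` (`F′.bg.Un cs′.j Φ₀.U`) and `w := v ū₁ v_j u_j`:
`‖∂(B^{w⁻¹})(p) − 1 − iξ·∂𝐊(p)‖ ≤ δ₀′ := ξ²·2B₃y² + ½(4x′)²ξ²e^{ξ·4x′}` (`x′ = B₃²O(1)Mα₀L^{j−1}η`, `y = B₃O(1)Mα₀L^{j−1}η`).  Route: `h339`; §1 at `exp iξ𝐇` with (3.37) `hH`;
`norm_curlK_sub_smul_curlH_le` at `τ = 1`. [cite: Balaban1987RG1, (3.37) p.277, (3.39)–(3.40) p.278, (3.43) p.278, (3.45) p.279] -/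
theorem norm_plaq_bgGauge_sub_one_sub_curlK_le (hξ : 0 < cs.ξ) (J : JInputs 𝓜 c F F' cs cs' Y π η B₃'' γ₀' j τ n K A) (hτ : τ = 1)
    (p : Plaq P i) (hp : p ∈ F.X.plaqs) :
    ‖((plaq (gaugeU (J.v * J.ubar1 * J.vj * J.uj)⁻¹ (F'.bg.Un cs'.j J.Φ₀.U)) p : 𝔸ˣ) : 𝔸) - 1
        - (I * cs.ξ) • (K ⟨p.src, p.μ⟩ + K ⟨p.src.shift p.μ, p.ν⟩ - K ⟨p.src.shift p.ν, p.μ⟩ - K ⟨p.src, p.ν⟩)‖ ≤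
      cs.ξ ^ 2 * (2 * (c.B₃ * (c.B₃ * c.O₁ * c.M * c.α₀ * (c.L ^ (j - 1) * η)) ^ 2))
        + 1 / 2 * (4 * (c.B₃ ^ 2 * c.O₁ * c.M * c.α₀ * (c.L ^ (j - 1) * η))) ^ 2 * cs.ξ ^ 2
            * Real.exp (cs.ξ * (4 * (c.B₃ ^ 2 * c.O₁ * c.M * c.α₀ * (c.L ^ (j - 1) * η)))) := by
  subst hτ
  set q : ℝ := c.B₃ * (c.B₃ * c.O₁ * c.M * c.α₀ * (c.L ^ (j - 1) * η)) ^ 2 with hq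
  set x' : ℝ := c.B₃ ^ 2 * c.O₁ * c.M * c.α₀ * (c.L ^ (j - 1) * η) with hx'
  set dK : 𝔸 := K ⟨p.src, p.μ⟩ + K ⟨p.src.shift p.μ, p.ν⟩ - K ⟨p.src.shift p.ν, p.μ⟩ - K ⟨p.src, p.ν⟩ with hdK
  set dH : 𝔸 := J.H ⟨p.src, p.μ⟩ + J.H ⟨p.src.shift p.μ, p.ν⟩ - J.H ⟨p.src.shift p.ν, p.μ⟩ - J.H ⟨p.src, p.ν⟩ with hdH
  -- (3.39)+(3.37): the plaquette of `exp iξ𝐇` IS the plaquette of `B^{w⁻¹}`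
  rw [← J.h339 p hp]
  -- §1 at `exp iξ𝐇`
  have hE : ‖((plaq (fun b => expI cs.ξ (J.H b)) p : 𝔸ˣ) : 𝔸) - 1 - (I * cs.ξ) • dH‖ ≤
      1 / 2 * (4 * x') ^ 2 * cs.ξ ^ 2 * Real.exp (cs.ξ * (4 * x')) :=
    norm_plaq_expI_sub_one_sub_curl_le hξ.le J.H (fun b => (J.hH b).le) p
  -- `‖∂𝐊 − ∂𝐇‖ ≤ 2ξq` at `τ = 1`
  have hKH : ‖dK - dH‖ ≤ cs.ξ * (2 * q) := by
    have h := norm_curlK_sub_smul_curlH_le hξ zero_le_one J p hp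
    simp only [Complex.ofReal_one, one_smul] at h
    calc ‖dK - dH‖ ≤ cs.ξ * ((1 + 1) * q) := h
      _ = cs.ξ * (2 * q) := by norm_num
  have hlin : ‖(I * cs.ξ) • dH - (I * cs.ξ) • dK‖ ≤ cs.ξ ^ 2 * (2 * q) := by
    rw [← smul_sub, norm_I_mul_smul hξ.le, norm_sub_rev]
    calc cs.ξ * ‖dK - dH‖ ≤ cs.ξ * (cs.ξ * (2 * q)) := mul_le_mul_of_nonneg_left hKH hξ.le
      _ = cs.ξ ^ 2 * (2 * q) := by ring
  have hsplit : ((plaq (fun b => expI cs.ξ (J.H b)) p : 𝔸ˣ) : 𝔸) - 1 - (I * cs.ξ) • dK =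
      (((plaq (fun b => expI cs.ξ (J.H b)) p : 𝔸ˣ) : 𝔸) - 1 - (I * cs.ξ) • dH) + ((I * cs.ξ) • dH - (I * cs.ξ) • dK) := by abel
  rw [hsplit]
  refine (norm_add_le _ _).trans ?_
  linarith

/-- **★ THE SAME FOR EVERY `τ ∈ [0, 1]`**: `‖τ·(∂(B^{w⁻¹})(p) − 1) − iξ·∂𝐊(p)‖ ≤ ξ²(1+τ)B₃y² + τ·½(4x′)²ξ²e^{ξ·4x′}` — the letter's curl is `τ` TIMES the pinned field strength to
second order (print: `𝐊 = 𝐇_j(□₀, τQ(…))` is linear in `τ` to first order); `τ = 1` is the identification above, `τ = 0` is `norm_curlK_le_of_tau_zero`.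
[cite: Balaban1987RG1, (3.37) p.277, (3.39)–(3.40) p.278, (3.43) p.278, (3.45) p.279] -/
theorem norm_smul_plaq_bgGauge_sub_one_sub_curlK_le (hξ : 0 < cs.ξ) (hτ : 0 ≤ τ) (J : JInputs 𝓜 c F F' cs cs' Y π η B₃'' γ₀' j τ n K A)
    (p : Plaq P i) (hp : p ∈ F.X.plaqs) :
    ‖(τ : ℂ) • (((plaq (gaugeU (J.v * J.ubar1 * J.vj * J.uj)⁻¹ (F'.bg.Un cs'.j J.Φ₀.U)) p : 𝔸ˣ) : 𝔸) - 1)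
        - (I * cs.ξ) • (K ⟨p.src, p.μ⟩ + K ⟨p.src.shift p.μ, p.ν⟩ - K ⟨p.src.shift p.ν, p.μ⟩ - K ⟨p.src, p.ν⟩)‖ ≤
      cs.ξ ^ 2 * ((1 + τ) * (c.B₃ * (c.B₃ * c.O₁ * c.M * c.α₀ * (c.L ^ (j - 1) * η)) ^ 2))
        + τ * (1 / 2 * (4 * (c.B₃ ^ 2 * c.O₁ * c.M * c.α₀ * (c.L ^ (j - 1) * η))) ^ 2 * cs.ξ ^ 2
            * Real.exp (cs.ξ * (4 * (c.B₃ ^ 2 * c.O₁ * c.M * c.α₀ * (c.L ^ (j - 1) * η))))) := by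
  set q : ℝ := c.B₃ * (c.B₃ * c.O₁ * c.M * c.α₀ * (c.L ^ (j - 1) * η)) ^ 2 with hq
  set x' : ℝ := c.B₃ ^ 2 * c.O₁ * c.M * c.α₀ * (c.L ^ (j - 1) * η) with hx'
  set dK : 𝔸 := K ⟨p.src, p.μ⟩ + K ⟨p.src.shift p.μ, p.ν⟩ - K ⟨p.src.shift p.ν, p.μ⟩ - K ⟨p.src, p.ν⟩ with hdK
  set dH : 𝔸 := J.H ⟨p.src, p.μ⟩ + J.H ⟨p.src.shift p.μ, p.ν⟩ - J.H ⟨p.src.shift p.ν, p.μ⟩ - J.H ⟨p.src, p.ν⟩ with hdH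
  rw [← J.h339 p hp]
  set Pl : 𝔸 := ((plaq (fun b => expI cs.ξ (J.H b)) p : 𝔸ˣ) : 𝔸) with hPl
  have hE : ‖Pl - 1 - (I * cs.ξ) • dH‖ ≤ 1 / 2 * (4 * x') ^ 2 * cs.ξ ^ 2 * Real.exp (cs.ξ * (4 * x')) :=
    norm_plaq_expI_sub_one_sub_curl_le hξ.le J.H (fun b => (J.hH b).le) p
  have hτE : ‖(τ : ℂ) • (Pl - 1 - (I * cs.ξ) • dH)‖ ≤ τ * (1 / 2 * (4 * x') ^ 2 * cs.ξ ^ 2 * Real.exp (cs.ξ * (4 * x'))) := by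
    rw [norm_smul, Complex.norm_real, Real.norm_of_nonneg hτ]
    exact mul_le_mul_of_nonneg_left hE hτ
  have hKH : ‖dK - (τ : ℂ) • dH‖ ≤ cs.ξ * ((1 + τ) * q) := norm_curlK_sub_smul_curlH_le hξ hτ J p hp
  have hlin : ‖(I * cs.ξ) • ((τ : ℂ) • dH - dK)‖ ≤ cs.ξ ^ 2 * ((1 + τ) * q) := by
    rw [norm_I_mul_smul hξ.le, norm_sub_rev]
    calc cs.ξ * ‖dK - (τ : ℂ) • dH‖ ≤ cs.ξ * (cs.ξ * ((1 + τ) * q)) := mul_le_mul_of_nonneg_left hKH hξ.le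
      _ = cs.ξ ^ 2 * ((1 + τ) * q) := by ring
  have hsplit : (τ : ℂ) • (Pl - 1) - (I * cs.ξ) • dK = (τ : ℂ) • (Pl - 1 - (I * cs.ξ) • dH) + (I * cs.ξ) • ((τ : ℂ) • dH - dK) := by
    module
  rw [hsplit]
  refine (norm_add_le _ _).trans ?_
  linarith

/-- **★ GENERAL-LETTER FLATNESS OF THE PINNED BACKGROUND** (PART 1's ★ `norm_plaq_bg_sub_one_le_of_jInputs` is the case `∂𝐊 = 0`): at `τ = 1`, `0 < ξ`, on `X`,
`‖∂B(p) − 1‖ ≤ e^{c_w}·(ξ‖∂𝐊(p)‖ + δ₀′)`, `c_w = O(1)Mα₁ + 2B₃O(1)Mα₀ + B₃²O(1)Mα₀` (the four costs, undoing the gauge of (3.39)).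
[cite: Balaban1987RG1, (3.26)–(3.27) p.275, (3.37) p.277, (3.39)–(3.40) p.278, (3.45) p.279] -/
theorem norm_plaq_bg_sub_one_le_curlK (hξ : 0 < cs.ξ) (J : JInputs 𝓜 c F F' cs cs' Y π η B₃'' γ₀' j τ n K A) (hτ : τ = 1)
    (p : Plaq P i) (hp : p ∈ F.X.plaqs) :
    ‖((plaq (F'.bg.Un cs'.j J.Φ₀.U) p : 𝔸ˣ) : 𝔸) - 1‖ ≤
      Real.exp (c.O₁ * c.M * c.α₁ + c.B₃ * c.O₁ * c.M * c.α₀ + c.B₃ * c.O₁ * c.M * c.α₀ + c.B₃ ^ 2 * c.O₁ * c.M * c.α₀) *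
        (cs.ξ * ‖K ⟨p.src, p.μ⟩ + K ⟨p.src.shift p.μ, p.ν⟩ - K ⟨p.src.shift p.ν, p.μ⟩ - K ⟨p.src, p.ν⟩‖
          + (cs.ξ ^ 2 * (2 * (c.B₃ * (c.B₃ * c.O₁ * c.M * c.α₀ * (c.L ^ (j - 1) * η)) ^ 2))
            + 1 / 2 * (4 * (c.B₃ ^ 2 * c.O₁ * c.M * c.α₀ * (c.L ^ (j - 1) * η))) ^ 2 * cs.ξ ^ 2
              * Real.exp (cs.ξ * (4 * (c.B₃ ^ 2 * c.O₁ * c.M * c.α₀ * (c.L ^ (j - 1) * η)))))) := by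
  set dK : 𝔸 := K ⟨p.src, p.μ⟩ + K ⟨p.src.shift p.μ, p.ν⟩ - K ⟨p.src.shift p.ν, p.μ⟩ - K ⟨p.src, p.ν⟩ with hdK
  have hid := norm_plaq_bgGauge_sub_one_sub_curlK_le hξ J hτ p hp
  set w := J.v * J.ubar1 * J.vj * J.uj with hw
  -- in the (3.39) gauge: `‖∂(B^{w⁻¹})(p) − 1‖ ≤ ξ‖∂𝐊(p)‖ + δ₀′`
  have hG : ‖((plaq (gaugeU w⁻¹ (F'.bg.Un cs'.j J.Φ₀.U)) p : 𝔸ˣ) : 𝔸) - 1‖ ≤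
      cs.ξ * ‖dK‖ + (cs.ξ ^ 2 * (2 * (c.B₃ * (c.B₃ * c.O₁ * c.M * c.α₀ * (c.L ^ (j - 1) * η)) ^ 2))
        + 1 / 2 * (4 * (c.B₃ ^ 2 * c.O₁ * c.M * c.α₀ * (c.L ^ (j - 1) * η))) ^ 2 * cs.ξ ^ 2
          * Real.exp (cs.ξ * (4 * (c.B₃ ^ 2 * c.O₁ * c.M * c.α₀ * (c.L ^ (j - 1) * η))))) := by
    have hsplit : ((plaq (gaugeU w⁻¹ (F'.bg.Un cs'.j J.Φ₀.U)) p : 𝔸ˣ) : 𝔸) - 1 =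
        (((plaq (gaugeU w⁻¹ (F'.bg.Un cs'.j J.Φ₀.U)) p : 𝔸ˣ) : 𝔸) - 1 - (I * cs.ξ) • dK) + (I * cs.ξ) • dK := by abel
    rw [hsplit]
    refine (norm_add_le _ _).trans ?_
    rw [norm_I_mul_smul hξ.le]
    linarith
  -- undo the gauge
  have hconj := norm_plaq_sub_one_le_conj w (F'.bg.Un cs'.j J.Φ₀.U) p
  have hcost : ‖((w p.src : 𝔸ˣ) : 𝔸)‖ * ‖(((w p.src)⁻¹ : 𝔸ˣ) : 𝔸)‖ ≤
      Real.exp (c.O₁ * c.M * c.α₁ + c.B₃ * c.O₁ * c.M * c.α₀ + c.B₃ * c.O₁ * c.M * c.α₀ + c.B₃ ^ 2 * c.O₁ * c.M * c.α₀) := by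
    simp only [hw, Pi.mul_apply]
    exact norm_mul_norm_inv_prod4_le (J.hv p.src) (J.hubar1 p.src) (J.hvj p.src) (J.huj p.src)
  calc ‖((plaq (F'.bg.Un cs'.j J.Φ₀.U) p : 𝔸ˣ) : 𝔸) - 1‖
      ≤ ‖((w p.src : 𝔸ˣ) : 𝔸)‖ * ‖((plaq (gaugeU w⁻¹ (F'.bg.Un cs'.j J.Φ₀.U)) p : 𝔸ˣ) : 𝔸) - 1‖ * ‖(((w p.src)⁻¹ : 𝔸ˣ) : 𝔸)‖ := hconj
    _ = (‖((w p.src : 𝔸ˣ) : 𝔸)‖ * ‖(((w p.src)⁻¹ : 𝔸ˣ) : 𝔸)‖) *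
          ‖((plaq (gaugeU w⁻¹ (F'.bg.Un cs'.j J.Φ₀.U)) p : 𝔸ˣ) : 𝔸) - 1‖ := by ring
    _ ≤ _ := mul_le_mul hcost hG (norm_nonneg _) (Real.exp_pos _).le

/-- **★ THE CONVERSE: THE PINNED BACKGROUND'S FIELD STRENGTH BOUNDS THE LETTER'S CURL FROM ABOVE** — at `τ = 1`, `0 < ξ`, on `X`,
`ξ‖∂𝐊(p)‖ ≤ e^{c_w}·‖∂B(p) − 1‖ + δ₀′`. [cite: Balaban1987RG1, (3.26)–(3.27) p.275, (3.37) p.277, (3.39)–(3.40) p.278, (3.45) p.279] -/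
theorem xi_mul_norm_curlK_le (hξ : 0 < cs.ξ) (J : JInputs 𝓜 c F F' cs cs' Y π η B₃'' γ₀' j τ n K A) (hτ : τ = 1)
    (p : Plaq P i) (hp : p ∈ F.X.plaqs) :
    cs.ξ * ‖K ⟨p.src, p.μ⟩ + K ⟨p.src.shift p.μ, p.ν⟩ - K ⟨p.src.shift p.ν, p.μ⟩ - K ⟨p.src, p.ν⟩‖ ≤
      Real.exp (c.O₁ * c.M * c.α₁ + c.B₃ * c.O₁ * c.M * c.α₀ + c.B₃ * c.O₁ * c.M * c.α₀ + c.B₃ ^ 2 * c.O₁ * c.M * c.α₀) *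
          ‖((plaq (F'.bg.Un cs'.j J.Φ₀.U) p : 𝔸ˣ) : 𝔸) - 1‖
        + (cs.ξ ^ 2 * (2 * (c.B₃ * (c.B₃ * c.O₁ * c.M * c.α₀ * (c.L ^ (j - 1) * η)) ^ 2))
          + 1 / 2 * (4 * (c.B₃ ^ 2 * c.O₁ * c.M * c.α₀ * (c.L ^ (j - 1) * η))) ^ 2 * cs.ξ ^ 2
            * Real.exp (cs.ξ * (4 * (c.B₃ ^ 2 * c.O₁ * c.M * c.α₀ * (c.L ^ (j - 1) * η))))) := by
  set dK : 𝔸 := K ⟨p.src, p.μ⟩ + K ⟨p.src.shift p.μ, p.ν⟩ - K ⟨p.src.shift p.ν, p.μ⟩ - K ⟨p.src, p.ν⟩ with hdK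
  have hid := norm_plaq_bgGauge_sub_one_sub_curlK_le hξ J hτ p hp
  set w := J.v * J.ubar1 * J.vj * J.uj with hw
  set Bw : 𝔸 := ((plaq (gaugeU w⁻¹ (F'.bg.Un cs'.j J.Φ₀.U)) p : 𝔸ˣ) : 𝔸) with hBw
  -- `ξ‖∂𝐊(p)‖ ≤ ‖∂(B^{w⁻¹})(p) − 1‖ + δ₀′`
  have h1 : cs.ξ * ‖dK‖ ≤ ‖Bw - 1‖ + (cs.ξ ^ 2 * (2 * (c.B₃ * (c.B₃ * c.O₁ * c.M * c.α₀ * (c.L ^ (j - 1) * η)) ^ 2))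
      + 1 / 2 * (4 * (c.B₃ ^ 2 * c.O₁ * c.M * c.α₀ * (c.L ^ (j - 1) * η))) ^ 2 * cs.ξ ^ 2
        * Real.exp (cs.ξ * (4 * (c.B₃ ^ 2 * c.O₁ * c.M * c.α₀ * (c.L ^ (j - 1) * η))))) := by
    have hsplit : (I * cs.ξ) • dK = (Bw - 1) - ((Bw - 1) - (I * cs.ξ) • dK) := by abel
    rw [← norm_I_mul_smul hξ.le dK, hsplit]
    refine (norm_sub_le _ _).trans ?_
    linarith
  -- conjugate back: `‖∂(B^{w⁻¹})(p) − 1‖ ≤ e^{c_w}‖∂B(p) − 1‖`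
  have hconj := norm_plaq_gaugeU_inv_sub_one_le w (F'.bg.Un cs'.j J.Φ₀.U) p
  have hcost : ‖((w p.src : 𝔸ˣ) : 𝔸)‖ * ‖(((w p.src)⁻¹ : 𝔸ˣ) : 𝔸)‖ ≤
      Real.exp (c.O₁ * c.M * c.α₁ + c.B₃ * c.O₁ * c.M * c.α₀ + c.B₃ * c.O₁ * c.M * c.α₀ + c.B₃ ^ 2 * c.O₁ * c.M * c.α₀) := by
    simp only [hw, Pi.mul_apply]
    exact norm_mul_norm_inv_prod4_le (J.hv p.src) (J.hubar1 p.src) (J.hvj p.src) (J.huj p.src)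
  have h2 : ‖Bw - 1‖ ≤ Real.exp (c.O₁ * c.M * c.α₁ + c.B₃ * c.O₁ * c.M * c.α₀ + c.B₃ * c.O₁ * c.M * c.α₀ + c.B₃ ^ 2 * c.O₁ * c.M * c.α₀) *
      ‖((plaq (F'.bg.Un cs'.j J.Φ₀.U) p : 𝔸ˣ) : 𝔸) - 1‖ := by
    calc ‖Bw - 1‖ ≤ ‖(((w p.src)⁻¹ : 𝔸ˣ) : 𝔸)‖ * ‖((plaq (F'.bg.Un cs'.j J.Φ₀.U) p : 𝔸ˣ) : 𝔸) - 1‖ * ‖((w p.src : 𝔸ˣ) : 𝔸)‖ := hconj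
      _ = (‖((w p.src : 𝔸ˣ) : 𝔸)‖ * ‖(((w p.src)⁻¹ : 𝔸ˣ) : 𝔸)‖) * ‖((plaq (F'.bg.Un cs'.j J.Φ₀.U) p : 𝔸ˣ) : 𝔸) - 1‖ := by ring
      _ ≤ _ := mul_le_mul_of_nonneg_right hcost (norm_nonneg _)
  linarith

/-- **★★ THE DATUM'S OWN (1.16) WINDOW CAPS THE LETTER'S CURL AT FIRST ORDER** — a law on the letter that EVERY by-reference package obeys, at ANY pin: the datum `Φ₀` satisfies
(iv) at `n = k+1` («`|∂U_{k+1}(□₀, M˙(𝐔)) − 1| < (1+2β)α₀ξ′²` on `(□₀)^{∼−2}`»), so for `X ⊆ (□₀)^{∼−2}` (the fundamental case) and `τ = 1`: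
`ξ‖∂𝐊(p)‖ < e^{c_w}(1+2β)α₀ξ′² + δ₀′` on `X`. [cite: Balaban1987RG1, (1.15)–(1.16) p.262, (3.40) p.278, (3.45) p.279] -/
theorem xi_mul_norm_curlK_lt_window (hξ : 0 < cs.ξ) (J : JInputs 𝓜 c F F' cs cs' Y π η B₃'' γ₀' j τ n K A) (hτ : τ = 1)
    (hj' : 1 ≤ cs'.j) (p : Plaq P i) (hp : p ∈ F.X.plaqs) (hpX₂ : p ∈ F'.X₂.plaqs) :
    cs.ξ * ‖K ⟨p.src, p.μ⟩ + K ⟨p.src.shift p.μ, p.ν⟩ - K ⟨p.src.shift p.ν, p.μ⟩ - K ⟨p.src, p.ν⟩‖ <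
      Real.exp (c.O₁ * c.M * c.α₁ + c.B₃ * c.O₁ * c.M * c.α₀ + c.B₃ * c.O₁ * c.M * c.α₀ + c.B₃ ^ 2 * c.O₁ * c.M * c.α₀) *
          ((1 + 2 * c.β) * c.α₀ * cs'.ξ ^ 2)
        + (cs.ξ ^ 2 * (2 * (c.B₃ * (c.B₃ * c.O₁ * c.M * c.α₀ * (c.L ^ (j - 1) * η)) ^ 2))
          + 1 / 2 * (4 * (c.B₃ ^ 2 * c.O₁ * c.M * c.α₀ * (c.L ^ (j - 1) * η))) ^ 2 * cs.ξ ^ 2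
            * Real.exp (cs.ξ * (4 * (c.B₃ ^ 2 * c.O₁ * c.M * c.α₀ * (c.L ^ (j - 1) * η))))) := by
  have h := xi_mul_norm_curlK_le hξ J hτ p hp
  obtain ⟨-, -, -, -, -, -, -, -, hIV, -⟩ := J.hΦ₀
  have hwin := hIV.plaq_lt cs'.j hj' le_rfl p hpX₂
  have hmono : Real.exp (c.O₁ * c.M * c.α₁ + c.B₃ * c.O₁ * c.M * c.α₀ + c.B₃ * c.O₁ * c.M * c.α₀ + c.B₃ ^ 2 * c.O₁ * c.M * c.α₀) *
      ‖((plaq (F'.bg.Un cs'.j J.Φ₀.U) p : 𝔸ˣ) : 𝔸) - 1‖ <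
        Real.exp (c.O₁ * c.M * c.α₁ + c.B₃ * c.O₁ * c.M * c.α₀ + c.B₃ * c.O₁ * c.M * c.α₀ + c.B₃ ^ 2 * c.O₁ * c.M * c.α₀) *
          ((1 + 2 * c.β) * c.α₀ * cs'.ξ ^ 2) :=
    mul_lt_mul_of_pos_left hwin (Real.exp_pos _)
  linarith

/-- **A FLAT PINNED BACKGROUND LEAVES THE LETTER SECOND-ORDER CLOSED**: if `∂B(p) = 1` then `ξ‖∂𝐊(p)‖ ≤ δ₀′` (`τ = 1`) — print's letter carries the pin's field strength; a flat pin
leaves it nothing to carry. [cite: Balaban1987RG1, (1.15) p.262, (3.39) p.278, (3.45) p.279 (bookkeeping)] -/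
theorem xi_mul_norm_curlK_le_of_flat_bg (hξ : 0 < cs.ξ) (J : JInputs 𝓜 c F F' cs cs' Y π η B₃'' γ₀' j τ n K A) (hτ : τ = 1)
    (p : Plaq P i) (hp : p ∈ F.X.plaqs) (hflat : plaq (F'.bg.Un cs'.j J.Φ₀.U) p = 1) :
    cs.ξ * ‖K ⟨p.src, p.μ⟩ + K ⟨p.src.shift p.μ, p.ν⟩ - K ⟨p.src.shift p.ν, p.μ⟩ - K ⟨p.src, p.ν⟩‖ ≤
      cs.ξ ^ 2 * (2 * (c.B₃ * (c.B₃ * c.O₁ * c.M * c.α₀ * (c.L ^ (j - 1) * η)) ^ 2))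
        + 1 / 2 * (4 * (c.B₃ ^ 2 * c.O₁ * c.M * c.α₀ * (c.L ^ (j - 1) * η))) ^ 2 * cs.ξ ^ 2
            * Real.exp (cs.ξ * (4 * (c.B₃ ^ 2 * c.O₁ * c.M * c.α₀ * (c.L ^ (j - 1) * η)))) := by
  have h := xi_mul_norm_curlK_le hξ J hτ p hp
  rw [hflat, Units.val_one, sub_self, norm_zero, mul_zero, zero_add] at h
  exact h

end Core

end Summit.QuantumFields.YangMills.BalabanUVNodes.N09B12LetterCurlIsPinnedFieldStrength

end
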